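import Summits.ValiantsHypothesis.ValiantsHypothesis.Theorems.LacunarySymmetroidMatrixDescartesCensusDoorA34SheetWindowGramSign

/-!
# `MatrixDescartes` census — DOOR A at `(3,4)`: the GRAM ORIENTATION PRINCIPLE behind both orientation laws (window supports) — a six-nomial with five positive
# roots is oriented by the SIGN OF ITS GRAM DETERMINANT; the Gram determinants of the three middle-block shapes (symmetric, Hermitian, bilinear) in closed form

HONEST FRAMING.  Object-search cell `pub-symmetroid`, engine seat `val-sym-eng-2` (g11); helper row beside the registered strata line
`Cruxes/DoorA34/Lines/strata.lean` on stmt-ValiantsHypothesis-19980 (`DoorA34 = PosRootLawAt 3 4 18`: OPEN, typed, never asserted here).  The two kernel orientation laws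
of this lineage — `Census.orientation_law` (g10: symmetric `2 × 2` determinants `T·L − A²`) and `Census.orientation_law_hermitian` (g11: `T·L − A² − B²`, the
semidefinite cell's middle block) — share one mechanism, isolated here as a theorem about ARBITRARY six-nomials on a window support:

* **`orientation_eq_sign_gramDet`** — GRAM ORIENTATION PRINCIPLE: let `f = c₀ + c₁x^{d₁} + c₂x^{2d₁} + c₃x^{d₂} + c₄x^{d₁+d₂} + c₅x^{2d₂}` (`0 < d₁`, `2d₁ < d₂`) have at
  least FIVE distinct positive roots and let `Δ = det Q_f = c₀c₂c₅ + c₁c₃c₄/4 − c₀c₄²/4 − c₂c₃²/4 − c₅c₁²/4` be its Gram determinant.  Then `Δ ≠ 0` and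
  `0 < c₅·Δ`, `c₀·Δ < 0`, `c₂·Δ < 0`: the top coefficient has the sign of `Δ`, the `x⁰` and `x^{2d₁}` coefficients the opposite sign.  (Interpolation: `c = λ·κ` with
  `κ` the cofactor vector of five roots, `Δ = λ³·det Q(κ)`, `det Q(κ) > 0` by `peel_gramDet_pos`.)  The two laws are the cases where `Δ ≥ 0` is known a priori
  (realisability square; Minkowski Cauchy–Schwarz at a root).
* **`bilinearGram_det_eq`** — for the BILINEAR shape `T·M − B₁·B₂` (the INDEFINITE cell's middle block `m = vᵀ adj(G) w` in the hyperbolic frame, g7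
  …SheetHyperbolicIsotropic): `Δ = (det[t,m,b₁]·det[t,m,b₂] − det[t,b₁,b₂]·det[m,b₁,b₂]) / 4` — a difference of products of `3 × 3` letter-coordinate determinants,
  of FREE sign; so in the indefinite cell a middle block with five window roots is positive beyond them iff that bracket is positive, and NO orientation law holds
  there (g10 report §6(f): «Gram inertia free», (5,2) realisable at block level) — the kernel form of why the indefinite cell is the residual cell of the flag analysis;
  `orientation_bilinear` spells the consequence out.
* (rev 2) **`orientation_eq_sign_gramDet_mirror`** — the same principle on NON-window supports `d₁ < d₂ < 2d₁` with the orientation REVERSED (`0 < c₀Δ`,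
  `c₅Δ < 0`, `c₂Δ < 0`), by `x ↦ 1/x` onto the window support `(0, d₂ − d₁, d₂)`: for symmetric `2 × 2` determinants «definite at 0⁺, indefinite beyond the last
  root» — the g10 report's located non-window mirror as a theorem.
* **`hermitianGram_det_eq`** — for `T·L − A² − B²`: `Δ = (det[t,l,a]² + det[t,l,b]²)/4 + det[t,a,b]·det[l,a,b]` (the last term is the space-like defect that
  `Census.hermitianGram_det_nonneg_of_root` shows cannot win when the six-nomial has a root); with `b = 0` it is g10's `(det M)²/4`.

Nothing here bounds the sheet; `DoorA34` and the three stubs stay OPEN; registers unchanged (`ζ_sym(3,4) ∈ {18,19}`); nothing on `MatrixDescartes`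
(stmt-ValiantsHypothesis-18050) or on `VP ≠ VNP` — VP≠VNP not moved.  [folklore] linear algebra of interpolation; Cauchy–Binet; `ring`.
-/

-- `Summit.ValiantsHypothesis.ValiantsHypothesis.…` repeats a component by the D-0017 layout
-- (single-conjunct summit), which the `dupNamespace` linter flags; the name is mandated.
set_option linter.dupNamespace false

namespace Summit.ValiantsHypothesis.ValiantsHypothesis.Theorems.LacunarySymmetroidMatrixDescartes.Census

open scoped BigOperators Matrix
open Polynomial Finset

/-! ## 1. The Gram orientation principle -/

/-- **GRAM ORIENTATION PRINCIPLE (window supports).**  A six-nomial `c₀ + c₁x^{d₁} + c₂x^{2d₁} + c₃x^{d₂} + c₄x^{d₁+d₂} + c₅x^{2d₂}` (`0 < d₁`, `2d₁ < d₂`) with at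
least five distinct positive roots has non-zero Gram determinant `Δ`, and `c₅` has the sign of `Δ` while `c₀`, `c₂` have the opposite sign. [folklore] -/
theorem orientation_eq_sign_gramDet (d₁ d₂ : ℕ) (hd₁ : 0 < d₁) (hw : 2 * d₁ < d₂) (c₀ c₁ c₂ c₃ c₄ c₅ : ℝ)
    (h5 : 5 ≤ (((C c₀ * X ^ 0 + C c₁ * X ^ d₁ + C c₂ * X ^ (2 * d₁) + C c₃ * X ^ d₂ + C c₄ * X ^ (d₁ + d₂) + C c₅ * X ^ (2 * d₂) : ℝ[X])).roots.toFinset.filter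
      (fun t => 0 < t)).card) :
    0 < c₅ * (c₀ * c₂ * c₅ + c₁ * c₃ * c₄ / 4 - c₀ * c₄ ^ 2 / 4 - c₂ * c₃ ^ 2 / 4 - c₅ * c₁ ^ 2 / 4)
      ∧ c₀ * (c₀ * c₂ * c₅ + c₁ * c₃ * c₄ / 4 - c₀ * c₄ ^ 2 / 4 - c₂ * c₃ ^ 2 / 4 - c₅ * c₁ ^ 2 / 4) < 0
      ∧ c₂ * (c₀ * c₂ * c₅ + c₁ * c₃ * c₄ / 4 - c₀ * c₄ ^ 2 / 4 - c₂ * c₃ ^ 2 / 4 - c₅ * c₁ ^ 2 / 4) < 0 := by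
  classical
  set E : Fin 6 → ℕ := ![0, d₁, 2 * d₁, d₂, d₁ + d₂, 2 * d₂] with hE
  have hEmono : StrictMono E := by
    refine Fin.strictMono_iff_lt_succ.2 fun i => ?_
    fin_cases i <;> simp [hE] <;> omega
  set q : Fin 6 → ℝ := ![c₀, c₁, c₂, c₃, c₄, c₅] with hq
  set f : ℝ[X] := (C c₀ * X ^ 0 + C c₁ * X ^ d₁ + C c₂ * X ^ (2 * d₁) + C c₃ * X ^ d₂ + C c₄ * X ^ (d₁ + d₂) + C c₅ * X ^ (2 * d₂) : ℝ[X]) with hf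
  have hfsum : f = ∑ j : Fin 6, C (q j) * X ^ E j := by
    rw [hf, Fin.sum_univ_six]; simp [hq, hE]
  have hfne : f ≠ 0 := by
    intro h0; rw [h0, roots_zero, Multiset.toFinset_zero, Finset.filter_empty, Finset.card_empty] at h5; omega
  obtain ⟨T, hTs, hTcard⟩ := Finset.exists_subset_card_eq h5
  set r : Fin 5 → ℝ := fun i => T.orderEmbOfFin hTcard i with hr
  have hrmono : StrictMono r := fun i j hij => (T.orderEmbOfFin hTcard).strictMono hij
  have hrmem : ∀ i, 0 < r i ∧ f.eval (r i) = 0 := by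
    intro i
    have hm := hTs (T.orderEmbOfFin_mem hTcard i)
    rw [Finset.mem_filter, Multiset.mem_toFinset, mem_roots hfne, IsRoot.def] at hm
    exact ⟨hm.2, hm.1⟩
  have hr0 : 0 < r 0 := (hrmem 0).1
  set D : Fin 6 → ℝ := fun j => (Matrix.of fun (i : Fin 5) (l : Fin 5) => r i ^ E (j.succAbove l)).det with hD
  set κ : Fin 6 → ℝ := fun j => (-1) ^ ((4 + 1) + (j : ℕ)) * D j with hκ
  have hDpos : ∀ j, 0 < D j := fun j =>
    genVandermonde_det_pos 4 r (fun l => E (j.succAbove l)) hrmono hr0 (hEmono.comp (Fin.strictMono_succAbove j))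
  have hWq : ∀ i, ∑ j, r i ^ E j * q j = 0 := by
    intro i
    have := (hrmem i).2
    rw [hfsum, eval_finsetSum] at this
    simp only [eval_mul, eval_C, eval_pow, eval_X] at this
    rw [← this]; exact Finset.sum_congr rfl fun j _ => mul_comm _ _
  have hWκ : ∀ i, ∑ j, r i ^ E j * κ j = 0 := by
    intro i
    have h := genVandermonde_det_eq_eval r E (r i)
    have hzero : (Matrix.of fun (i' : Fin 6) (j : Fin 6) => (Fin.snoc r (r i) : Fin 6 → ℝ) i' ^ E j).det = 0 := by
      refine Matrix.det_zero_of_row_eq (i := Fin.castSucc i) (j := Fin.last 5) (Fin.castSucc_lt_last i).ne ?_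
      ext j; simp only [Matrix.of_apply, Fin.snoc_castSucc, Fin.snoc_last]
    rw [hzero, eval_finsetSum] at h
    simp only [eval_mul, eval_C, eval_pow, eval_X] at h
    rw [h]; exact Finset.sum_congr rfl fun j _ => by simp only [hκ, hD]; ring
  set lam : ℝ := q (Fin.last 5) / κ (Fin.last 5) with hlam
  have hκ5 : κ (Fin.last 5) = D (Fin.last 5) := by
    rw [hκ]; simp only [Fin.val_last]
    rw [show (4 + 1 + 5 : ℕ) = 2 * 5 by norm_num, pow_mul, neg_one_sq, one_pow, one_mul]
  have hκ5ne : κ (Fin.last 5) ≠ 0 := by rw [hκ5]; exact (hDpos _).ne'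
  have hv5 : q (Fin.last 5) - lam * κ (Fin.last 5) = 0 := by rw [hlam]; field_simp; ring
  have hv : ∀ j, q j - lam * κ j = 0 := by
    set v : Fin 5 → ℝ := fun l => q (Fin.castSucc l) - lam * κ (Fin.castSucc l) with hvdef
    have hW' : (Matrix.of fun (i : Fin 5) (l : Fin 5) => r i ^ E (Fin.castSucc l)) *ᵥ v = 0 := by
      ext i
      simp only [Matrix.mulVec, dotProduct, Matrix.of_apply, Pi.zero_apply, hvdef]
      have h1 := hWq i; have h2 := hWκ i
      rw [Fin.sum_univ_castSucc] at h1 h2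
      have hsplit : ∑ x : Fin 5, r i ^ E (Fin.castSucc x) * (q (Fin.castSucc x) - lam * κ (Fin.castSucc x))
          = (∑ x : Fin 5, r i ^ E (Fin.castSucc x) * q (Fin.castSucc x)) - lam * ∑ x : Fin 5, r i ^ E (Fin.castSucc x) * κ (Fin.castSucc x) := by
        rw [Finset.mul_sum, ← Finset.sum_sub_distrib]; exact Finset.sum_congr rfl fun x _ => by ring
      rw [hsplit]
      linear_combination h1 - lam * h2 - (r i ^ E (Fin.last 5)) * hv5
    have hdet : (Matrix.of fun (i : Fin 5) (l : Fin 5) => r i ^ E (Fin.castSucc l)).det ≠ 0 :=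
      genVandermonde_det_ne_zero r (fun l => E (Fin.castSucc l)) hrmono.injective (fun i => (hrmem i).1)
        (hEmono.comp Fin.strictMono_castSucc).injective
    have hv0 : v = 0 := Matrix.eq_zero_of_mulVec_eq_zero hdet hW'
    intro j
    induction j using Fin.lastCases with
    | last => exact hv5
    | cast l => have := congrFun hv0 l; simpa [hvdef] using this
  have hqκ : ∀ j, q j = lam * κ j := fun j => by linarith [hv j]
  have hrvec : (![r 0, r 1, r 2, r 3, r 4] : Fin 5 → ℝ) = r := by ext i; fin_cases i <;> rfl
  have hD' : ∀ j : Fin 6, D j = (Matrix.of fun (i : Fin 5) (l : Fin 5) =>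
      (![r 0, r 1, r 2, r 3, r 4] : Fin 5 → ℝ) i ^ (![0, d₁, 2 * d₁, d₂, d₁ + d₂, 2 * d₂] : Fin 6 → ℕ) (j.succAbove l)).det := by
    intro j; rw [hrvec]
  have h01 : r 0 < r 1 := hrmono (show (0 : Fin 5) < 1 by decide)
  have h12 : r 1 < r 2 := hrmono (show (1 : Fin 5) < 2 by decide)
  have h23 : r 2 < r 3 := hrmono (show (2 : Fin 5) < 3 by decide)
  have h34 : r 3 < r 4 := hrmono (show (3 : Fin 5) < 4 by decide)
  have hpeel : 0 < D 0 * D 2 * D 5 - D 1 * D 3 * D 4 / 4 + D 0 * D 4 ^ 2 / 4 + D 2 * D 3 ^ 2 / 4 - D 5 * D 1 ^ 2 / 4 :=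
    peel_gramDet_pos d₁ d₂ hd₁ hw (r 0) (r 1) (r 2) (r 3) (r 4) hr0 h01 h12 h23 h34 D hD'
  set P : ℝ := D 0 * D 2 * D 5 - D 1 * D 3 * D 4 / 4 + D 0 * D 4 ^ 2 / 4 + D 2 * D 3 ^ 2 / 4 - D 5 * D 1 ^ 2 / 4 with hPdef
  have hQκ : κ 0 * κ 2 * κ 5 + κ 1 * κ 3 * κ 4 / 4 - κ 0 * κ 4 ^ 2 / 4 - κ 2 * κ 3 ^ 2 / 4 - κ 5 * κ 1 ^ 2 / 4 = P := by
    simp only [hPdef, hκ, show ((0 : Fin 6) : ℕ) = 0 from rfl, show ((1 : Fin 6) : ℕ) = 1 from rfl, show ((2 : Fin 6) : ℕ) = 2 from rfl,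
      show ((3 : Fin 6) : ℕ) = 3 from rfl, show ((4 : Fin 6) : ℕ) = 4 from rfl, show ((5 : Fin 6) : ℕ) = 5 from rfl]
    norm_num
    ring
  have hq0 : q 0 = c₀ := rfl
  have hq1 : q 1 = c₁ := rfl
  have hq2 : q 2 = c₂ := rfl
  have hq3 : q 3 = c₃ := rfl
  have hq4 : q 4 = c₄ := rfl
  have hq5 : q 5 = c₅ := rfl
  have hcube : c₀ * c₂ * c₅ + c₁ * c₃ * c₄ / 4 - c₀ * c₄ ^ 2 / 4 - c₂ * c₃ ^ 2 / 4 - c₅ * c₁ ^ 2 / 4 = lam ^ 3 * P := by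
    rw [← hq0, ← hq1, ← hq2, ← hq3, ← hq4, ← hq5, ← hQκ, hqκ 0, hqκ 1, hqκ 2, hqκ 3, hqκ 4, hqκ 5]; ring
  have hκ0 : κ 0 = -D 0 := by rw [hκ]; simp only [show ((0 : Fin 6) : ℕ) = 0 from rfl]; norm_num
  have hκ2 : κ 2 = -D 2 := by rw [hκ]; simp only [show ((2 : Fin 6) : ℕ) = 2 from rfl]; norm_num
  have hκ5' : κ 5 = D 5 := by rw [hκ]; simp only [show ((5 : Fin 6) : ℕ) = 5 from rfl]; norm_num
  have hc5 : c₅ = lam * D 5 := by rw [← hq5, hqκ 5, hκ5']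
  have hc0 : c₀ = -(lam * D 0) := by rw [← hq0, hqκ 0, hκ0]; ring
  have hc2 : c₂ = -(lam * D 2) := by rw [← hq2, hqκ 2, hκ2]; ring
  have hlam_ne : lam ≠ 0 := by
    intro h0
    apply hfne
    rw [hfsum]
    refine Finset.sum_eq_zero fun j _ => ?_
    rw [hqκ j, h0, zero_mul, map_zero, zero_mul]
  have hlam4 : 0 < lam ^ 4 := by positivity
  rw [hcube, hc5, hc0, hc2]
  refine ⟨?_, ?_, ?_⟩
  · have : lam * D 5 * (lam ^ 3 * P) = lam ^ 4 * (D 5 * P) := by ring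
    rw [this]; exact mul_pos hlam4 (mul_pos (hDpos 5) hpeel)
  · have : -(lam * D 0) * (lam ^ 3 * P) = -(lam ^ 4 * (D 0 * P)) := by ring
    rw [this]; exact neg_neg_of_pos (mul_pos hlam4 (mul_pos (hDpos 0) hpeel))
  · have : -(lam * D 2) * (lam ^ 3 * P) = -(lam ^ 4 * (D 2 * P)) := by ring
    rw [this]; exact neg_neg_of_pos (mul_pos hlam4 (mul_pos (hDpos 2) hpeel))

/-- Corollary: five positive roots on a window support force a NON-DEGENERATE Gram matrix (the contrapositive of
`Census.card_posRoots_le_four_of_gram_det_eq_zero`, here read off the principle). [folklore] -/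
theorem gramDet_ne_zero_of_five_roots (d₁ d₂ : ℕ) (hd₁ : 0 < d₁) (hw : 2 * d₁ < d₂) (c₀ c₁ c₂ c₃ c₄ c₅ : ℝ)
    (h5 : 5 ≤ (((C c₀ * X ^ 0 + C c₁ * X ^ d₁ + C c₂ * X ^ (2 * d₁) + C c₃ * X ^ d₂ + C c₄ * X ^ (d₁ + d₂) + C c₅ * X ^ (2 * d₂) : ℝ[X])).roots.toFinset.filter
      (fun t => 0 < t)).card) :
    c₀ * c₂ * c₅ + c₁ * c₃ * c₄ / 4 - c₀ * c₄ ^ 2 / 4 - c₂ * c₃ ^ 2 / 4 - c₅ * c₁ ^ 2 / 4 ≠ 0 := by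
  intro h0
  have h := (orientation_eq_sign_gramDet d₁ d₂ hd₁ hw c₀ c₁ c₂ c₃ c₄ c₅ h5).1
  rw [h0, mul_zero] at h
  exact lt_irrefl _ h

/-! ## 2. The Gram determinants of the three middle-block shapes -/

/-- **Bilinear shape** `T·M − B₁·B₂` (the indefinite cell's middle block in the hyperbolic frame): its Gram determinant is
`(det[t,m,b₁]·det[t,m,b₂] − det[t,b₁,b₂]·det[m,b₁,b₂])/4`, of FREE sign — no orientation law in the indefinite cell. [folklore] -/
theorem bilinearGram_det_eq (t₀ t₁ t₂ m₀ m₁ m₂ p₀ p₁ p₂ q₀ q₁ q₂ : ℝ) :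
    let c₀ := t₀ * m₀ - p₀ * q₀
    let c₁ := t₀ * m₁ + t₁ * m₀ - p₀ * q₁ - p₁ * q₀
    let c₂ := t₁ * m₁ - p₁ * q₁
    let c₃ := t₀ * m₂ + t₂ * m₀ - p₀ * q₂ - p₂ * q₀
    let c₄ := t₁ * m₂ + t₂ * m₁ - p₁ * q₂ - p₂ * q₁
    let c₅ := t₂ * m₂ - p₂ * q₂
    c₀ * c₂ * c₅ + c₁ * c₃ * c₄ / 4 - c₀ * c₄ ^ 2 / 4 - c₂ * c₃ ^ 2 / 4 - c₅ * c₁ ^ 2 / 4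
      = ((!![t₀, m₀, p₀; t₁, m₁, p₁; t₂, m₂, p₂] : Matrix (Fin 3) (Fin 3) ℝ).det * (!![t₀, m₀, q₀; t₁, m₁, q₁; t₂, m₂, q₂] : Matrix (Fin 3) (Fin 3) ℝ).det
        - (!![t₀, p₀, q₀; t₁, p₁, q₁; t₂, p₂, q₂] : Matrix (Fin 3) (Fin 3) ℝ).det * (!![m₀, p₀, q₀; m₁, p₁, q₁; m₂, p₂, q₂] : Matrix (Fin 3) (Fin 3) ℝ).det) / 4 := by
  simp only [Matrix.det_fin_three, Matrix.of_apply, Matrix.cons_val', Matrix.cons_val_zero, Matrix.cons_val_one, Matrix.cons_val_two, Matrix.empty_val',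
    Matrix.cons_val_fin_one, Matrix.head_cons, Matrix.tail_cons, Matrix.head_fin_const]
  ring

/-- **Hermitian shape** `T·L − A² − B²` (the semidefinite cell's middle block): its Gram determinant is
`(det[t,l,a]² + det[t,l,b]²)/4 + det[t,a,b]·det[l,a,b]`; the last term is the space-like defect (with `b = 0` this is the realisability square
`Census.polarGram_det_eq_sq_div_four`). [folklore] -/
theorem hermitianGram_det_eq (t₀ t₁ t₂ l₀ l₁ l₂ a₀ a₁ a₂ b₀ b₁ b₂ : ℝ) :
    (t₀ * l₀ - a₀ ^ 2 - b₀ ^ 2) * (t₁ * l₁ - a₁ ^ 2 - b₁ ^ 2) * (t₂ * l₂ - a₂ ^ 2 - b₂ ^ 2)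
        + (t₀ * l₁ + t₁ * l₀ - 2 * a₀ * a₁ - 2 * b₀ * b₁) * (t₀ * l₂ + t₂ * l₀ - 2 * a₀ * a₂ - 2 * b₀ * b₂)
            * (t₁ * l₂ + t₂ * l₁ - 2 * a₁ * a₂ - 2 * b₁ * b₂) / 4
        - (t₀ * l₀ - a₀ ^ 2 - b₀ ^ 2) * (t₁ * l₂ + t₂ * l₁ - 2 * a₁ * a₂ - 2 * b₁ * b₂) ^ 2 / 4
        - (t₁ * l₁ - a₁ ^ 2 - b₁ ^ 2) * (t₀ * l₂ + t₂ * l₀ - 2 * a₀ * a₂ - 2 * b₀ * b₂) ^ 2 / 4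
        - (t₂ * l₂ - a₂ ^ 2 - b₂ ^ 2) * (t₀ * l₁ + t₁ * l₀ - 2 * a₀ * a₁ - 2 * b₀ * b₁) ^ 2 / 4
      = ((!![t₀, l₀, a₀; t₁, l₁, a₁; t₂, l₂, a₂] : Matrix (Fin 3) (Fin 3) ℝ).det ^ 2
          + (!![t₀, l₀, b₀; t₁, l₁, b₁; t₂, l₂, b₂] : Matrix (Fin 3) (Fin 3) ℝ).det ^ 2) / 4
        + (!![t₀, a₀, b₀; t₁, a₁, b₁; t₂, a₂, b₂] : Matrix (Fin 3) (Fin 3) ℝ).det * (!![l₀, a₀, b₀; l₁, a₁, b₁; l₂, a₂, b₂] : Matrix (Fin 3) (Fin 3) ℝ).det := by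
  simp only [Matrix.det_fin_three, Matrix.of_apply, Matrix.cons_val', Matrix.cons_val_zero, Matrix.cons_val_one, Matrix.cons_val_two, Matrix.empty_val',
    Matrix.cons_val_fin_one, Matrix.head_cons, Matrix.tail_cons, Matrix.head_fin_const]
  ring

/-- **The indefinite cell's middle block is oriented by a free bracket.**  If the bilinear six-nomial `T·M − B₁·B₂` (trinomials on `(0, d₁, d₂)`, window support)
has at least five distinct positive roots, then its top coefficient `t₂m₂ − p₂q₂` has the sign of `det[t,m,b₁]·det[t,m,b₂] − det[t,b₁,b₂]·det[m,b₁,b₂]`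
(which the letters may give either sign: no orientation law in the indefinite cell). [folklore] -/
theorem orientation_bilinear (d₁ d₂ : ℕ) (hd₁ : 0 < d₁) (hw : 2 * d₁ < d₂) (t₀ t₁ t₂ m₀ m₁ m₂ p₀ p₁ p₂ q₀ q₁ q₂ : ℝ)
    (h5 : 5 ≤ (((C (t₀ * m₀ - p₀ * q₀) * X ^ 0 + C (t₀ * m₁ + t₁ * m₀ - p₀ * q₁ - p₁ * q₀) * X ^ d₁ + C (t₁ * m₁ - p₁ * q₁) * X ^ (2 * d₁)
        + C (t₀ * m₂ + t₂ * m₀ - p₀ * q₂ - p₂ * q₀) * X ^ d₂ + C (t₁ * m₂ + t₂ * m₁ - p₁ * q₂ - p₂ * q₁) * X ^ (d₁ + d₂)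
        + C (t₂ * m₂ - p₂ * q₂) * X ^ (2 * d₂) : ℝ[X])).roots.toFinset.filter (fun t => 0 < t)).card) :
    0 < (t₂ * m₂ - p₂ * q₂) *
      ((!![t₀, m₀, p₀; t₁, m₁, p₁; t₂, m₂, p₂] : Matrix (Fin 3) (Fin 3) ℝ).det * (!![t₀, m₀, q₀; t₁, m₁, q₁; t₂, m₂, q₂] : Matrix (Fin 3) (Fin 3) ℝ).det
        - (!![t₀, p₀, q₀; t₁, p₁, q₁; t₂, p₂, q₂] : Matrix (Fin 3) (Fin 3) ℝ).det * (!![m₀, p₀, q₀; m₁, p₁, q₁; m₂, p₂, q₂] : Matrix (Fin 3) (Fin 3) ℝ).det) := by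
  have h := (orientation_eq_sign_gramDet d₁ d₂ hd₁ hw _ _ _ _ _ _ h5).1
  have e := bilinearGram_det_eq t₀ t₁ t₂ m₀ m₁ m₂ p₀ p₁ p₂ q₀ q₁ q₂
  simp only at e
  rw [e] at h
  linarith

/-! ## 3. The mirror principle (non-window supports `d₁ < d₂ < 2d₁`) — rev 2 -/

/-- **MIRROR GRAM ORIENTATION PRINCIPLE (non-window supports).**  For `0 < d₁ < d₂ < 2d₁` a six-nomial
`c₀ + c₁x^{d₁} + c₂x^{2d₁} + c₃x^{d₂} + c₄x^{d₁+d₂} + c₅x^{2d₂}` with at least five distinct positive roots has `0 < c₀·Δ`, `c₅·Δ < 0`, `c₂·Δ < 0` (`Δ` its Gram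
determinant): the orientation of the window case REVERSED — for a symmetric `2 × 2` determinant (`Δ ≥ 0`) the pencil is DEFINITE at `0⁺` and indefinite beyond its last
root, the located «non-window mirror» of the g10 report §6(c).  Proof: `x ↦ 1/x` turns the six-nomial into one on the window support `(0, d₂ − d₁, d₂)` with the
coefficient tuple reversed `(c₅, c₄, c₂, c₃, c₁, c₀)` and the same Gram determinant; apply `orientation_eq_sign_gramDet`. [folklore] -/
theorem orientation_eq_sign_gramDet_mirror (d₁ d₂ : ℕ) (hd : d₁ < d₂) (hnw : d₂ < 2 * d₁) (c₀ c₁ c₂ c₃ c₄ c₅ : ℝ)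
    (h5 : 5 ≤ (((C c₀ * X ^ 0 + C c₁ * X ^ d₁ + C c₂ * X ^ (2 * d₁) + C c₃ * X ^ d₂ + C c₄ * X ^ (d₁ + d₂) + C c₅ * X ^ (2 * d₂) : ℝ[X])).roots.toFinset.filter
      (fun t => 0 < t)).card) :
    0 < c₀ * (c₀ * c₂ * c₅ + c₁ * c₃ * c₄ / 4 - c₀ * c₄ ^ 2 / 4 - c₂ * c₃ ^ 2 / 4 - c₅ * c₁ ^ 2 / 4)
      ∧ c₅ * (c₀ * c₂ * c₅ + c₁ * c₃ * c₄ / 4 - c₀ * c₄ ^ 2 / 4 - c₂ * c₃ ^ 2 / 4 - c₅ * c₁ ^ 2 / 4) < 0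
      ∧ c₂ * (c₀ * c₂ * c₅ + c₁ * c₃ * c₄ / 4 - c₀ * c₄ ^ 2 / 4 - c₂ * c₃ ^ 2 / 4 - c₅ * c₁ ^ 2 / 4) < 0 := by
  classical
  set f : ℝ[X] := (C c₀ * X ^ 0 + C c₁ * X ^ d₁ + C c₂ * X ^ (2 * d₁) + C c₃ * X ^ d₂ + C c₄ * X ^ (d₁ + d₂) + C c₅ * X ^ (2 * d₂) : ℝ[X]) with hf
  -- the mirrored six-nomial on the window support (0, d₂ − d₁, d₂)
  set e₁ : ℕ := d₂ - d₁ with he₁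
  have he₁pos : 0 < e₁ := by omega
  have hwin : 2 * e₁ < d₂ := by omega
  set g : ℝ[X] := (C c₅ * X ^ 0 + C c₄ * X ^ e₁ + C c₂ * X ^ (2 * e₁) + C c₃ * X ^ d₂ + C c₁ * X ^ (e₁ + d₂) + C c₀ * X ^ (2 * d₂) : ℝ[X]) with hg
  have hfne : f ≠ 0 := by
    intro h0; rw [h0, roots_zero, Multiset.toFinset_zero, Finset.filter_empty, Finset.card_empty] at h5; omega
  -- g(1/t)·t^{2d₂} = f(t) for t ≠ 0
  have hpow : ∀ (t : ℝ), t ≠ 0 → ∀ a b : ℕ, a + b = 2 * d₂ → (t⁻¹) ^ a * t ^ (2 * d₂) = t ^ b := by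
    intro t ht a b hab
    rw [← hab, pow_add, ← mul_assoc, ← mul_pow, inv_mul_cancel₀ ht, one_pow, one_mul]
  have hmirror : ∀ t : ℝ, t ≠ 0 → g.eval t⁻¹ * t ^ (2 * d₂) = f.eval t := by
    intro t ht
    simp only [hg, hf, eval_add, eval_mul, eval_C, eval_pow, eval_X]
    have h0 := hpow t ht 0 (2 * d₂) (by omega)
    have h1 := hpow t ht e₁ (d₁ + d₂) (by omega)
    have h2 := hpow t ht (2 * e₁) (2 * d₁) (by omega)
    have h3 := hpow t ht d₂ d₂ (by omega)
    have h4 := hpow t ht (e₁ + d₂) d₁ (by omega)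
    have h5' := hpow t ht (2 * d₂) 0 (by omega)
    calc (c₅ * t⁻¹ ^ 0 + c₄ * t⁻¹ ^ e₁ + c₂ * t⁻¹ ^ (2 * e₁) + c₃ * t⁻¹ ^ d₂ + c₁ * t⁻¹ ^ (e₁ + d₂) + c₀ * t⁻¹ ^ (2 * d₂)) * t ^ (2 * d₂)
        = c₅ * (t⁻¹ ^ 0 * t ^ (2 * d₂)) + c₄ * (t⁻¹ ^ e₁ * t ^ (2 * d₂)) + c₂ * (t⁻¹ ^ (2 * e₁) * t ^ (2 * d₂)) + c₃ * (t⁻¹ ^ d₂ * t ^ (2 * d₂))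
          + c₁ * (t⁻¹ ^ (e₁ + d₂) * t ^ (2 * d₂)) + c₀ * (t⁻¹ ^ (2 * d₂) * t ^ (2 * d₂)) := by ring
      _ = c₀ * t ^ 0 + c₁ * t ^ d₁ + c₂ * t ^ (2 * d₁) + c₃ * t ^ d₂ + c₄ * t ^ (d₁ + d₂) + c₅ * t ^ (2 * d₂) := by
        rw [h0, h1, h2, h3, h4, h5']; ring
  have hgne : g ≠ 0 := by
    intro hg0
    -- then f(t) = 0 for every t ≠ 0: f has infinitely many roots, impossible for f ≠ 0
    have hall : ∀ t : ℝ, t ≠ 0 → f.IsRoot t := fun t ht => by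
      rw [IsRoot.def, ← hmirror t ht, hg0, eval_zero, zero_mul]
    have hinf : Set.Infinite {t : ℝ | f.IsRoot t} :=
      Set.Infinite.mono (fun t (ht : t ∈ Set.Ioi (0 : ℝ)) => hall t (ne_of_gt ht)) (Set.Ioi_infinite 0)
    exact hinf (Polynomial.finite_setOf_isRoot hfne)
  -- the positive roots of f inject into those of g under t ↦ t⁻¹
  have h5g : 5 ≤ ((g.roots.toFinset.filter (fun t => 0 < t)).card) := by
    refine h5.trans (Finset.card_le_card_of_injOn (fun t => t⁻¹) (fun t ht => ?_) ?_)
    · rw [Finset.mem_coe, Finset.mem_filter, Multiset.mem_toFinset, mem_roots hfne] at ht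
      rw [Finset.mem_coe, Finset.mem_filter, Multiset.mem_toFinset, mem_roots hgne, IsRoot.def]
      refine ⟨?_, inv_pos.mpr ht.2⟩
      have hm := hmirror t ht.2.ne'
      rw [ht.1.eq_zero] at hm  -- hm : g.eval t⁻¹ * t^(2d₂) = 0
      rcases mul_eq_zero.1 hm with h | h
      · exact h
      · exact absurd (pow_eq_zero_iff (by omega) |>.1 h) ht.2.ne'
    · intro a ha b hb hab
      simpa using congrArg (fun z : ℝ => z⁻¹) hab
  have hP := orientation_eq_sign_gramDet e₁ d₂ he₁pos hwin c₅ c₄ c₂ c₃ c₁ c₀ h5g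
  have hΔ : c₅ * c₂ * c₀ + c₄ * c₃ * c₁ / 4 - c₅ * c₁ ^ 2 / 4 - c₂ * c₃ ^ 2 / 4 - c₀ * c₄ ^ 2 / 4
      = c₀ * c₂ * c₅ + c₁ * c₃ * c₄ / 4 - c₀ * c₄ ^ 2 / 4 - c₂ * c₃ ^ 2 / 4 - c₅ * c₁ ^ 2 / 4 := by ring
  rw [hΔ] at hP
  exact ⟨hP.1, hP.2.1, hP.2.2⟩

end Summit.ValiantsHypothesis.ValiantsHypothesis.Theorems.LacunarySymmetroidMatrixDescartes.Census
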